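import Summits.QuantumAdvantage.QuantumAdvantage.Theorems.SosSandwichTransferPBWalkMachineDefs
import HarnessLib

/-!
# Route `SosSandwich`, crux `TransferPB` (stmt-QuantumAdvantage-15238): the reference machine's step function as a PLAIN RECURSIVE REPLAY (definitions)

`Defs` file (D-0016 convention; no theorem proved here). The last piece of the machine half of stub
`stub_pbOracleSimulation` is the programming fact (P') `(walkMachine (pw∘length) (pd∘length)).IsPolyTime`
(`Theorems/SosSandwichTransferPBWalkMachineFinal.lean`), i.e. that the transcript step function
`(x, answers) ↦ OracleComp.toStep (machineComp … x) answers` is polynomial-time. A machine for it REPLAYS the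
computation against the recorded answers (`Literature/Computability/Complexity/OracleReplay.lean`); following the
tree's pattern for Shor's classical part (`Literature/Computability/Cryptography/ShorReplay.lean`) this file gives
that replay as first-order recursive functions — the specification an `FP`/stack program is verified against:

* `askR q as` — one decoded query: stuck on `q`, or (first answer bit, rest);
* `filterR`, `flatMapR`, `forEachAskR` — replays of `filterComp`, `flatMapComp`, `forEach (askG ∘ g)`;
* `liveR`, `candsR`, `walkR`, `meansR` — replays of `liveComp`, `candsComp`, `walkComp`, `meansComp`;
* **`machineStepR Wf Df x as`** — the pending query or the output bit; `step_walkMachine`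
  (`Theorems/SosSandwichTransferPBWalkReplay.lean`): `(walkMachine Wf Df).step x as = machineStepR Wf Df x as`.

Sources: S. Arora, B. Barak, Computational Complexity (CUP 2009), §3.4 Def. 3.4 (configurations are determined by
the input and the answers so far); S. Aaronson, A. Ambainis, Theory Comput. 10 (2014), proof of Thm. 23 (p. 14).
-/

-- D-0017: single-conjunct summit ⇒ the duplicate `QuantumAdvantage.QuantumAdvantage` is mandated.
set_option linter.dupNamespace false

noncomputable section

namespace Summit.QuantumAdvantage.QuantumAdvantage.Cruxes.TransferPB.Birth

open Finset Literature.Computability.Cryptography Literature.Computability.Complexity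
  Literature.Computability.QuantumComplexity Literature.Computability.QuantumComplexity.ClassicalSimulation

namespace SimTreePB


section ReplayDefs

variable {α β : Type}

/-- Replay of a decoded one-query block (`askG`/`askA` with query `q`): stuck on `q` without an answer, otherwise the
decoded first answer and the rest. -/
def askR (q : List Bool) : List (List Bool) → List Bool ⊕ (Bool × List (List Bool))
  | [] => Sum.inl q
  | a :: as => Sum.inr (Computability.decodeBool a, as)

/-- Replay of `filterComp` given the replays of the tests. -/
def filterR (pR : α → List (List Bool) → List Bool ⊕ (Bool × List (List Bool))) :
    List α → List (List Bool) → List Bool ⊕ (List α × List (List Bool))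
  | [], as => Sum.inr ([], as)
  | a :: l, as =>
    match pR a as with
    | Sum.inl q => Sum.inl q
    | Sum.inr (b, as') =>
      match filterR pR l as' with
      | Sum.inl q => Sum.inl q
      | Sum.inr (l', as'') => Sum.inr (if b = true then a :: l' else l', as'')

/-- Replay of `flatMapComp` given the replays of the parts. -/
def flatMapR (fR : α → List (List Bool) → List Bool ⊕ (List β × List (List Bool))) :
    List α → List (List Bool) → List Bool ⊕ (List β × List (List Bool))
  | [], as => Sum.inr ([], as)
  | a :: l, as =>
    match fR a as with
    | Sum.inl q => Sum.inl q
    | Sum.inr (m, as') =>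
      match flatMapR fR l as' with
      | Sum.inl q => Sum.inl q
      | Sum.inr (m', as'') => Sum.inr (m ++ m', as'')

/-- Replay of `forEach` of decoded one-query blocks with queries `g a`. -/
def forEachAskR (g : α → List Bool) : List α → List (List Bool) → List Bool ⊕ (List Bool × List (List Bool))
  | [], as => Sum.inr ([], as)
  | a :: l, as =>
    match askR (g a) as with
    | Sum.inl q => Sum.inl q
    | Sum.inr (b, as') =>
      match forEachAskR g l as' with
      | Sum.inl q => Sum.inl q
      | Sum.inr (bs, as'') => Sum.inr (b :: bs, as'')

variable (x : List Bool)

/-- Replay of `liveComp x π j`. -/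
def liveR (π : List (List Bool × Bool)) : ℕ → List (List Bool) → List Bool ⊕ (List (List Bool) × List (List Bool))
  | 0, as =>
    match askR (true :: encBlockS x π []) as with
    | Sum.inl q => Sum.inl q
    | Sum.inr (b, as') => Sum.inr (if b = true then [[]] else [], as')
  | j + 1, as =>
    match liveR π j as with
    | Sum.inl q => Sum.inl q
    | Sum.inr (L, as') =>
      flatMapR (fun u => filterR (fun v => askR (true :: encBlockS x π v)) [u ++ [false], u ++ [true]]) L as'

/-- Replay of `candsComp x π W`. -/
def candsR (π : List (List Bool × Bool)) (W : ℕ) (as : List (List Bool)) :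
    List Bool ⊕ (List (List Bool) × List (List Bool)) :=
  match flatMapR (liveR x π) (List.range W) as with
  | Sum.inl q => Sum.inl q
  | Sum.inr (all, as') =>
    filterR (fun u bs => match askR (true :: encSingleS x π u) bs with
      | Sum.inl q => Sum.inl q
      | Sum.inr (b, bs') => Sum.inr (b && decide (u ∉ π.map Prod.fst), bs')) all as'

/-- Replay of `walkComp x W D π`. -/
def walkR (W : ℕ) : ℕ → List (List Bool × Bool) → List (List Bool) →
    List Bool ⊕ (List (List Bool × Bool) × List (List Bool))
  | 0, π, as => Sum.inr (π, as)
  | D + 1, π, as =>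
    match candsR x π W as with
    | Sum.inl q => Sum.inl q
    | Sum.inr (c, as') =>
      match c.argmin strNum with
      | none => Sum.inr (π, as')
      | some u =>
        match askR (false :: u) as' with
        | Sum.inl q => Sum.inl q
        | Sum.inr (b, as'') => walkR W D (π ++ [(u, b)]) as''

/-- Replay of `meansComp x π`. -/
def meansR (π : List (List Bool × Bool)) (as : List (List Bool)) : List Bool ⊕ (List Bool × List (List Bool)) :=
  forEachAskR (fun j => true :: encMeanS x π j) (Icc 1 40).toList as

end ReplayDefs

/-- **The step function of the reference machine as a plain recursive replay**: on input `x` and recorded answers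
`as`, replay the walk, then the MEAN block; report the pending query, or the output bit. -/
def machineStepR (Wf Df : List Bool → ℕ) (x : List Bool) (as : List (List Bool)) : List Bool ⊕ Bool :=
  match walkR x (Wf x) (Df x) [] as with
  | Sum.inl q => Sum.inl q
  | Sum.inr (π, as') =>
    match meansR x π as' with
    | Sum.inl q => Sum.inl q
    | Sum.inr (bs, _) => Sum.inr (decide (20 ≤ (bs.filter fun b => b = true).length))

end SimTreePB

end Summit.QuantumAdvantage.QuantumAdvantage.Cruxes.TransferPB.Birth

end
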